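import Summits.KontsevichZagierPeriods.KontsevichZagierPeriods.Theorems.LinRedNormalFormArrangementNormalFormSeparateEngine

/-!
# The contact-aware separation engine (stub `stub_separateThreeZero`, part `Induction`)

(Line `janus-bands`, crux `ArrangementNormalForm`, stub `stub_separateThreeZero` — fibre-free
separation over a bounded rational polytope in `ℝ³`, `JJ 3 0 → closure (GG 2 1 0)`; part
`Induction`, stated in every base dimension `b + 1` with `k` fibres.)

## The 3-d far-first engine: paper decision

After the fan lemma with every active letter moved (`separateHigh_fan_active`) and the base
change making the direction `v` the distinguished coordinate `y`, a piece `D` carries poles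
`y − λ_j(x')` (ALL touching letters are poles: `v` is transversal to every active letter plane),
the RATIO condition `|y − λ_{j'}| ≤ C |λ_j − λ_{j'}|` on `D` for every ordered pair of distinct
active poles, and no `x'`-letter except non-zero constants. The partial-fraction step of the pair
`(j, j')` appends the wall `λ_j − λ_{j'}`; by the ratio condition (which passes to the closure)
the wall vanishes on `D̄` exactly on the CONTACT SET `T_{jj'} = {z ∈ D̄ : y = λ_j = λ_{j'}}` of the
crossing line of the two pole planes, where every vertical fibre of `D̄` is degenerate. Hence the
rim condition (R) of `separateThree_hI` can only be met through its first disjunct: at the end,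
`T_{jj'}` must lie on the plane of the surviving pole, for every pair split along the branch.

**Splitting rule** (the 3-d "far-first order"): split a pair `(j, j')` of distinct active poles
only if `T_{jj'}` lies on EVERY currently active pole plane. The invariant handed down the
induction (`sepC_induction` below) is then: every `x'`-letter `c` with non-zero exponent
satisfies `∀ z ∈ D̄, c(z) = 0 → (some pole is active) ∧ (every active pole plane contains z)`;
it is monotone under lowering multiplicities, holds for the new wall by the splitting rule, and
at a terminal piece (all active poles equal to `ℓ`, `n = ∑ d_j`) it is literally the first
disjunct `n ≠ 0 ∧ y = ℓ(x')` of (R). Far pairs (`T_{jj'} = ∅`) are always splittable, so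
"far first" is a special case of the rule; no harmlessness bookkeeping is needed.

**Existence of a splittable pair** (hypothesis `hunb`, "hereditarily unblocked"): for every set
`S` of active poles containing two distinct ones, some pair in `S` has `T_{jj'} ⊆ ⋂_{i∈S} Hᵢ`.
With `G_i = H_i ∩ D̄` the contact faces, a family is BLOCKED iff no pairwise meet equals the
total meet. Classification (part `Unblocked`): if every contact `G_i` lies in a line (THIN
letters: no active letter plane meets `D̄₀` in a 2-dimensional set) the only blocked family is the
TRIANGLE — three contact edges `AB, BC, CA` of `D̄` (E_Δ = [{x,y,z>0, x+y+z<1},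
1/((x+z)(y+z)(1−x−y+z))]: contact edges = the three edges of the bottom face; W5's bipyramid:
the equator) — and its vertices are SPECIAL POINTS (singleton contacts `H_j ∩ H_{j'} ∩ D̄₀`);
a rational grid finer than the minimal distance of two special points leaves at most one special
point per closed piece, hence no triangle, hence `hunb` (families with a common vertex are never
blocked: if all pairwise meets strictly contain the vertex, all contacts are one common edge).
Facet contacts (letter planes containing a facet of a piece, forced by cutting along a letter
plane that meets the open input cell or contains a facet of it — then `L^e ∣ P` by absolute
convergence) admit further blocked families (three facets around a simple corner: the fake
octant `[{x,y,z>0,…}, xyz·Q/(xyz·…)]`); they are resolved either by CANCELLING the divisible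
letters (analytic lemma: integrability near a 2-dimensional contact forces `L^e ∣ P`) or by a
flag (barycentric) subdivision, under which all contacts of a piece form a CHAIN and `hunb` is
trivial. The conditional assembly of this part of the stub therefore carries the input hypothesis
THIN; the cancellation lemma `JJ 3 0 ≡ thin JJ 3 0` is the remaining split of the stub.

Test configurations: (a) a polar plane touching `D̄` along an edge: it is a pole (transversal
`v`), its contact edge is where walls against it may vanish, on its own plane ✓; (b) two polar
planes through a vertex `V` with different contact edges: `T = {V}`, splittable, both contain
`V` ✓; (c) the genuine octant corner `[{x,y,z>0}, P/((x+y)(y+z)(x+z))]`: contacts = the three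
axes, common vertex `0`, pairwise meets `{0}` = total meet ✓ unblocked for every `v`; (d) the
bipyramid / E_Δ triangle: blocked as a whole, unblocked after the grid (each closed piece sees
at most one vertex of the triangle); (e) E₀, E₁ of `hHI3.md` are excluded: their offending letter
is `v`-inactive and touching, which `separateHigh_fan_active` rules out (all touching letters
are poles).
-/

noncomputable section

open Set MeasureTheory Filter Topology

namespace Summit.KontsevichZagierPeriods.ArrangementNormalForm.JanusBands

open Literature.NumberTheory.Transcendental

namespace SepThree

open SeparatePos

variable {b k : ℕ}

/-- Base affine forms are continuous. -/
theorem wall_continuous_affB (c : (Fin b → ℚ) × ℚ) : Continuous (affB b k c) := by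
  unfold affB; fun_prop

/-- The ratio condition passes to the closure of the cell. -/
theorem wall_ratio_closure {σ : Set (Fin (b + 1 + k) → ℝ)} {c c' : (Fin b → ℚ) × ℚ} {C : ℝ}
    (h : ∀ z ∈ σ, |z (Fin.castAdd k (Fin.last b)) - affB b k c' z| ≤
      C * |affB b k c z - affB b k c' z|) :
    ∀ z ∈ closure σ, |z (Fin.castAdd k (Fin.last b)) - affB b k c' z| ≤
      C * |affB b k c z - affB b k c' z| := by
  intro z hz
  have hc : IsClosed {z : Fin (b + 1 + k) → ℝ | |z (Fin.castAdd k (Fin.last b)) - affB b k c' z| ≤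
      C * |affB b k c z - affB b k c' z|} :=
    isClosed_le ((continuous_apply _).sub (wall_continuous_affB c')).abs
      (continuous_const.mul ((wall_continuous_affB c).sub (wall_continuous_affB c')).abs)
  exact closure_minimal (fun z hz => h z hz) hc hz

/-- A point of the closed cell where the wall `λ − λ'` of a pair with the ratio condition
vanishes lies on both pole planes (the contact set of the pair). -/
theorem contact_of_wall {σ : Set (Fin (b + 1 + k) → ℝ)} {c c' : (Fin b → ℚ) × ℚ} {C : ℝ}
    (h : ∀ z ∈ σ, |z (Fin.castAdd k (Fin.last b)) - affB b k c' z| ≤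
      C * |affB b k c z - affB b k c' z|) {z : Fin (b + 1 + k) → ℝ} (hz : z ∈ closure σ)
    (h0 : affB b k (c - c') z = 0) :
    z (Fin.castAdd k (Fin.last b)) = affB b k c z ∧
      z (Fin.castAdd k (Fin.last b)) = affB b k c' z := by
  rw [affB_sub] at h0
  have h1 := wall_ratio_closure h z hz
  rw [h0, abs_zero, mul_zero] at h1
  have h2 : z (Fin.castAdd k (Fin.last b)) - affB b k c' z = 0 :=
    abs_eq_zero.1 (le_antisymm h1 (abs_nonneg _))
  constructor <;> linarith

/-- **The contact-aware separation engine.** The engine `SeparatePos.sep_induction` (iterated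
rule (1b), every piece dominated by the RATIO condition) with the ORDER of the splittings
controlled by the splitting rule — a pair of distinct active poles is split only if its contact
set lies on every active pole plane (`hunb` supplies such a pair as long as two distinct poles are
active) — and the CONTACT INVARIANT handed to the terminal class: every `x'`-letter with non-zero
exponent vanishes on the closed cell only at points lying on every active pole plane, some pole
being active. -/
theorem sepC_induction (b k m' r : ℕ) (M : Fin m' → (Fin (b + 1) → ℚ) × ℚ)
    (p : MvPolynomial (Fin (b + 1)) ℚ) (lam : Fin r → (Fin b → ℚ) × ℚ)
    (a : Fin k → Option ((Fin (b + 1) → ℚ) × ℚ))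
    (lo hi : Fin k → Fin k ⊕ ((Fin (b + 1) → ℚ) × ℚ)) (act : Fin r → Prop)
    (T : Set KZ.FormalRep)
    (hT : ∀ (m : ℕ) (L : Fin m → (Fin b → ℚ) × ℚ) (e : Fin m → ℕ) (d : Fin r → ℕ)
      (s : KZ.IntegralRep (b + 1 + k)) (ℓ : (Fin b → ℚ) × ℚ), Bornology.IsBounded s.domain →
      s.domain = gDom b k m' M lo hi → EqOn s.integrand (shape b k p L e lam d a) s.domain →
      (∀ j, d j ≠ 0 → ∀ z ∈ s.domain, z (Fin.castAdd k (Fin.last b)) - affB b k (lam j) z ≠ 0) →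
      (∀ j, d j ≠ 0 → lam j = ℓ) →
      (∀ l, e l ≠ 0 → ∀ z ∈ closure s.domain, affB b k (L l) z = 0 →
        (∃ i, d i ≠ 0) ∧ ∀ i, d i ≠ 0 → z (Fin.castAdd k (Fin.last b)) = affB b k (lam i) z) →
      KZ.of s ∈ T)
    (hrat : ∀ j j', act j → act j' → lam j ≠ lam j' →
      ∃ C, ∀ z ∈ gDom b k m' M lo hi, |z (Fin.castAdd k (Fin.last b)) - affB b k (lam j') z| ≤
        C * |affB b k (lam j) z - affB b k (lam j') z|)
    (hunb : ∀ S : Fin r → Prop, (∀ j, S j → act j) → (∃ j j', S j ∧ S j' ∧ lam j ≠ lam j') →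
      ∃ j j', S j ∧ S j' ∧ lam j ≠ lam j' ∧ ∀ z ∈ closure (gDom b k m' M lo hi),
        z (Fin.castAdd k (Fin.last b)) = affB b k (lam j) z →
        z (Fin.castAdd k (Fin.last b)) = affB b k (lam j') z →
        ∀ i, S i → z (Fin.castAdd k (Fin.last b)) = affB b k (lam i) z)
    (N : ℕ) :
    ∀ (m : ℕ) (L : Fin m → (Fin b → ℚ) × ℚ) (e : Fin m → ℕ) (d : Fin r → ℕ)
      (s : KZ.IntegralRep (b + 1 + k)), ∑ j, d j = N → Bornology.IsBounded s.domain →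
      s.domain = gDom b k m' M lo hi → EqOn s.integrand (shape b k p L e lam d a) s.domain →
      (∀ j, d j ≠ 0 → ∀ z ∈ s.domain, z (Fin.castAdd k (Fin.last b)) - affB b k (lam j) z ≠ 0) →
      (∀ j, d j ≠ 0 → act j) →
      (∀ l, e l ≠ 0 → ∀ z ∈ closure s.domain, affB b k (L l) z = 0 →
        (∃ i, d i ≠ 0) ∧ ∀ i, d i ≠ 0 → z (Fin.castAdd k (Fin.last b)) = affB b k (lam i) z) →
      ∃ c ∈ AddSubgroup.closure T, KZ.of s - c ∈ KZ.relations := by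
  induction N with
  | zero =>
    intro m L e d s hN hbd hdom hint hpole _ hinv
    have hd : ∀ j, d j = 0 := fun j => (Finset.sum_eq_zero_iff.mp hN) j (Finset.mem_univ j)
    exact ⟨KZ.of s, AddSubgroup.subset_closure (hT m L e d s 0 hbd hdom hint hpole
      (fun j hj => absurd (hd j) hj) hinv), by simp⟩
  | succ N ih =>
    intro m L e d s hN hbd hdom hint hpole hact hinv
    by_cases hsplit : ∃ j j', d j ≠ 0 ∧ d j' ≠ 0 ∧ lam j ≠ lam j'
    · -- a splittable pair
      obtain ⟨j, j', hj, hj', hne, hcont⟩ := hunb (fun i => d i ≠ 0) hact hsplit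
      obtain ⟨C₁, hC₁⟩ := hrat j j' (hact j hj) (hact j' hj') hne
      obtain ⟨C₂, hC₂⟩ := hrat j' j (hact j' hj') (hact j hj) hne.symm
      rw [← hdom] at hC₁ hC₂ hcont
      obtain ⟨s₁, hd₁, hg₁, hi₁⟩ := exists_piece L e p lam d a s hint j j' hj' (hpole j' hj') hC₁
      obtain ⟨s₂, hd₂, hg₂, hi₂⟩ := exists_piece L e p lam d a s hint j' j hj (hpole j hj) hC₂
      have hrel : KZ.of s - KZ.of s₁ - KZ.of s₂ ∈ KZ.relations := by
        refine KZ.integrandAddRel_subset_relations ⟨_, s, s₁, s₂, hd₁, hd₂, fun z hz => ?_, rfl⟩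
        have hR : affB b k (lam j) z - affB b k (lam j') z ≠ 0 := fun h => hpole j' hj' z hz
          (abs_eq_zero.mp (le_antisymm (by simpa [h] using hC₁ z hz) (abs_nonneg _)))
        have key : (z (Fin.castAdd k (Fin.last b)) - affB b k (lam j') z) /
              (affB b k (lam j) z - affB b k (lam j') z) +
            (z (Fin.castAdd k (Fin.last b)) - affB b k (lam j) z) /
              (affB b k (lam j') z - affB b k (lam j) z) = 1 := by
          rw [show affB b k (lam j') z - affB b k (lam j) z =
              -(affB b k (lam j) z - affB b k (lam j') z) by ring, div_neg, ← sub_eq_add_neg,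
            ← sub_div, div_eq_one_iff_eq hR]
          ring
        rw [Pi.add_apply, hg₁, hg₂, ← mul_add, key, mul_one]
      have hsum : ∀ i : Fin r, d i ≠ 0 → ∑ l, Function.update d i (d i - 1) l = N := by
        intro i hi
        rw [Finset.sum_update_of_mem (Finset.mem_univ _)]
        have h1 := Finset.sum_eq_add_sum_sdiff_singleton_of_mem (Finset.mem_univ i) d
        omega
      have hex : ∀ i : Fin r, d i ≠ 0 → ∃ l, Function.update d i (d i - 1) l ≠ 0 := by
        intro i hi
        by_contra hall; push Not at hall
        have h0 : ∑ l, Function.update d i (d i - 1) l = 0 := Finset.sum_eq_zero fun l _ => hall l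
        rw [hsum i hi] at h0
        have h2 : ∑ l, d l ≥ 2 := by
          have hjj' : j ≠ j' := fun h => hne (h ▸ rfl)
          have := Finset.add_le_sum (f := d) (fun _ _ => Nat.zero_le _) (Finset.mem_univ j)
            (Finset.mem_univ j') hjj'
          omega
        omega
      -- the contact invariant of the two pieces
      have hnew : ∀ (d' : Fin r → ℕ), (∀ i, d' i ≠ 0 → d i ≠ 0) → (∃ i, d' i ≠ 0) →
          ∀ (i₁ i₂ : Fin r) (C : ℝ), (i₁ = j ∧ i₂ = j') ∨ (i₁ = j' ∧ i₂ = j) →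
          (∀ z ∈ s.domain, |z (Fin.castAdd k (Fin.last b)) - affB b k (lam i₂) z| ≤
            C * |affB b k (lam i₁) z - affB b k (lam i₂) z|) →
          ∀ l, (Fin.snoc e 1 : Fin (m + 1) → ℕ) l ≠ 0 → ∀ z ∈ closure s.domain,
            affB b k ((Fin.snoc L (lam i₁ - lam i₂) : Fin (m + 1) → (Fin b → ℚ) × ℚ) l) z = 0 →
            (∃ i, d' i ≠ 0) ∧ ∀ i, d' i ≠ 0 →
              z (Fin.castAdd k (Fin.last b)) = affB b k (lam i) z := by
        intro d' hd' hex' i₁ i₂ C hii hC l hl z hz h0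
        refine ⟨hex', ?_⟩
        revert hl h0
        refine Fin.lastCases ?_ (fun l => ?_) l
        · intro _ h0
          simp only [Fin.snoc_last] at h0
          obtain ⟨h1, h2⟩ := contact_of_wall hC hz h0
          intro i hi
          rcases hii with ⟨rfl, rfl⟩ | ⟨rfl, rfl⟩
          · exact hcont z hz h1 h2 i (hd' i hi)
          · exact hcont z hz h2 h1 i (hd' i hi)
        · intro hl h0
          simp only [Fin.snoc_castSucc] at hl h0
          exact fun i hi => (hinv l hl z hz h0).2 i (hd' i hi)
      have hI₁ := hnew _ (fun i => ne_zero_of_update_ne_zero) (hex j' hj') j j' C₁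
        (Or.inl ⟨rfl, rfl⟩) hC₁
      have hI₂ := hnew _ (fun i => ne_zero_of_update_ne_zero) (hex j hj) j' j C₂
        (Or.inr ⟨rfl, rfl⟩) hC₂
      obtain ⟨c₁, hc₁, hr₁⟩ := ih (m + 1) _ _ _ s₁ (hsum j' hj') (by rw [hd₁]; exact hbd)
        (hd₁.trans hdom) hi₁
        (fun i hi z hz => hpole i (ne_zero_of_update_ne_zero hi) z (by rw [← hd₁]; exact hz))
        (fun i hi => hact i (ne_zero_of_update_ne_zero hi)) (by rw [hd₁]; exact hI₁)
      obtain ⟨c₂, hc₂, hr₂⟩ := ih (m + 1) _ _ _ s₂ (hsum j hj) (by rw [hd₂]; exact hbd)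
        (hd₂.trans hdom) hi₂
        (fun i hi z hz => hpole i (ne_zero_of_update_ne_zero hi) z (by rw [← hd₂]; exact hz))
        (fun i hi => hact i (ne_zero_of_update_ne_zero hi)) (by rw [hd₂]; exact hI₂)
      refine ⟨c₁ + c₂, add_mem hc₁ hc₂, ?_⟩
      have : KZ.of s - (c₁ + c₂) =
          (KZ.of s - KZ.of s₁ - KZ.of s₂) + (KZ.of s₁ - c₁) + (KZ.of s₂ - c₂) := by abel
      rw [this]
      exact add_mem (add_mem hrel hr₁) hr₂
    · -- terminal
      push Not at hsplit
      have hℓ : ∃ ℓ, ∀ j, d j ≠ 0 → lam j = ℓ := by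
        by_cases h : ∃ j, d j ≠ 0
        · obtain ⟨j₀, hj₀⟩ := h
          exact ⟨lam j₀, fun j hj => hsplit j j₀ hj hj₀⟩
        · push Not at h
          exact ⟨0, fun j hj => absurd (h j) hj⟩
      obtain ⟨ℓ, hℓ⟩ := hℓ
      exact ⟨KZ.of s, AddSubgroup.subset_closure (hT m L e d s ℓ hbd hdom hint hpole hℓ hinv),
        by simp⟩

end SepThree

open SepThree SeparatePos in
/-- **The wall of a split pair vanishes on the closed cell only on the contact set of the pair**
(registered sub-goal of `stub_separateThreeZero`, part `Induction`): under the ratio condition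
`|y − λ'| ≤ C |λ − λ'|` on a cell, a point of its closure where the wall `λ − λ'` vanishes lies on
both pole planes `y = λ(x')`, `y = λ'(x')`. -/
theorem separateThree_contact_of_wall (b k : ℕ) (σ : Set (Fin (b + 1 + k) → ℝ)) (c c' : (Fin b → ℚ) × ℚ) (C : ℝ) (h : ∀ z ∈ σ, |z (Fin.castAdd k (Fin.last b)) - SeparatePos.affB b k c' z| ≤ C * |SeparatePos.affB b k c z - SeparatePos.affB b k c' z|) (z : Fin (b + 1 + k) → ℝ) (hz : z ∈ closure σ) (h0 : SeparatePos.affB b k (c - c') z = 0) : z (Fin.castAdd k (Fin.last b)) = SeparatePos.affB b k c z ∧ z (Fin.castAdd k (Fin.last b)) = SeparatePos.affB b k c' z :=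
  contact_of_wall h hz h0

end Summit.KontsevichZagierPeriods.ArrangementNormalForm.JanusBands
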